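import Mathlib

/-!
# THE SECTOR DICHOTOMY (ROUND-42 «THE CONDENSER», step (B3): at least half of the directions are short)

Width piece for crux `EulerZoomLiouville.PowerGaugeEulerLiouville` (stmt-NavierStokesRegularity-19832), by name under
LEAD 19832 (ns-typeII-p2 g12); seat ns-ezl-w2 g3, `--supports stmt-NavierStokesRegularity-19832 --as helper`.
Companion of `…CondenserLengthArea` (t42-LA), same polar chart `polarCoord` of `ℝ × ℝ`, Mathlib only.  In the
length–area lemma the directions `θ` must be SHORT (the ray meets `{‖g‖ ≤ m/2}` at some radius `r ∈ [w₀, r★]`).  Here: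

* `measurableSet_shortDirections` — the set of short directions
  `{θ ∈ (−π, π) | ∃ r ∈ [w₀, r★], ‖g(r u_θ)‖ ≤ m/2}` is measurable (trace on `(−π, π)` of the projection of a compact set).
* `integral_fst_prod_eq` — the swept area `∫_{[w₀,r★] ×ˢ T} r = ((r★² − w₀²)/2)·vol(T).toReal`.
* **`pi_le_volume_shortDirections` — THE SECTOR DICHOTOMY**: if `g` is continuous, `0 < m`, `0 < w₀ < r★`, the energy of `g`
  on the swept annular sector is `∫_{polarCoord.symm '' ([w₀,r★] ×ˢ (−π,π))} ‖g‖² ≤ a`, and there is ROOM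
  `8a/(π m²) ≤ r★² − w₀²`, then the short directions have measure `≥ π`.
  [The LONG directions sweep the region `polarCoord.symm '' ([w₀,r★] ×ˢ long)` on which `‖g‖ > m/2`; its weighted area is
  `((r★² − w₀²)/2)·vol(long)` (change of variables, Jacobian `r`), so `(m²/4)((r★² − w₀²)/2)vol(long) ≤ a`, i.e.
  `vol(long) ≤ 8a/(m²(r★² − w₀²)) ≤ π`, and `vol(short) = 2π − vol(long) ≥ π`.]

With Chebyshev (`a ≤` the planar `L²`-budget of `V` on the quiet plane) this feeds `pi_mul_sq_le_log_mul_integral` in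
nsreg-p2 g33's THEOREM B without spherical symmetrisation.

HONEST FRAMING: a lemma of real analysis in the plane; nothing here proves the crux E `PowerGaugeEulerLiouville` (19832 OPEN),
any door Target, or any Navier–Stokes statement; MODEL lattice only (19832 is a crux CLASS — E/NS strata — not NS regularity).
[folklore (length–area method); cite: ConstantinIgnatovaVicol2026Putative, §3.4.1 for the setting]
-/

noncomputable section

open Set Filter Topology Metric Function MeasureTheory Real

set_option linter.dupNamespace false

namespace Summit.NavierStokesRegularity.NavierStokesRegularity.Theorems.PowerGaugeEulerLiouville.Condenser

/-- The polar chart `(r, θ) ↦ (r cos θ, r sin θ)` is continuous on all of `ℝ × ℝ`. [folklore] -/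
theorem continuous_polarCoord_symm : Continuous fun p : ℝ × ℝ => polarCoord.symm p := by
  simp only [polarCoord_symm_apply]
  fun_prop

/-- The short directions inside `(−π, π)` are the trace of the projection of a compact set. [folklore] -/
theorem shortDirections_eq {F : Type*} [NormedAddCommGroup F] (g : ℝ × ℝ → F) (m w₀ rs : ℝ) :
    {θ ∈ Ioo (-Real.pi) Real.pi | ∃ r ∈ Icc w₀ rs, ‖g (polarCoord.symm (r, θ))‖ ≤ m / 2} =
      Ioo (-Real.pi) Real.pi ∩ Prod.snd ''
        ((Icc w₀ rs ×ˢ Icc (-Real.pi) Real.pi) ∩ {p : ℝ × ℝ | ‖g (polarCoord.symm p)‖ ≤ m / 2}) := by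
  ext θ
  constructor
  · rintro ⟨hθ, r, hr, h⟩
    exact ⟨hθ, ⟨(r, θ), ⟨⟨hr, Ioo_subset_Icc_self hθ⟩, h⟩, rfl⟩⟩
  · rintro ⟨hθ, ⟨p, ⟨⟨hp1, _⟩, hp⟩, rfl⟩⟩
    exact ⟨hθ, p.1, hp1, hp⟩

/-- **The set of short directions is measurable** (for continuous `g`). [folklore] -/
theorem measurableSet_shortDirections {F : Type*} [NormedAddCommGroup F] {g : ℝ × ℝ → F} (hgc : Continuous g)
    (m w₀ rs : ℝ) :
    MeasurableSet {θ ∈ Ioo (-Real.pi) Real.pi | ∃ r ∈ Icc w₀ rs, ‖g (polarCoord.symm (r, θ))‖ ≤ m / 2} := by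
  rw [shortDirections_eq]
  refine measurableSet_Ioo.inter (IsCompact.isClosed ?_).measurableSet
  exact ((isCompact_Icc.prod isCompact_Icc).inter_right
    (isClosed_le (hgc.comp continuous_polarCoord_symm).norm continuous_const)).image continuous_snd

/-- The swept (Jacobian-weighted) area of `[w₀, r★] ×ˢ T`: `∫ r = ((r★² − w₀²)/2)·vol(T).toReal`. [folklore] -/
theorem integral_fst_prod_eq {w₀ rs : ℝ} (hwr : w₀ ≤ rs) (T : Set ℝ) :
    ∫ p in Icc w₀ rs ×ˢ T, p.1 = (rs ^ 2 - w₀ ^ 2) / 2 * (volume T).toReal := by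
  have key := setIntegral_prod_mul (μ := (volume : Measure ℝ)) (ν := (volume : Measure ℝ)) (s := Icc w₀ rs)
    (t := T) (fun r : ℝ => r) (fun _ : ℝ => (1 : ℝ))
  simp only [mul_one] at key
  have h2 : ∫ r in Icc w₀ rs, r = (rs ^ 2 - w₀ ^ 2) / 2 := by
    rw [integral_Icc_eq_integral_Ioc, ← intervalIntegral.integral_of_le hwr, integral_id]
  have h3 : ∫ _θ in T, (1 : ℝ) = (volume T).toReal := by
    simp [measureReal_def]
  rw [Measure.volume_eq_prod, key, h2, h3]

/-- **THE SECTOR DICHOTOMY.**  `g` continuous on `ℝ × ℝ`, `0 < m`, `0 < w₀ < r★`; if the energy of `g` on the swept annular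
sector is `∫_{polarCoord.symm '' ([w₀, r★] ×ˢ (−π, π))} ‖g‖² ≤ a` and `8a/(π m²) ≤ r★² − w₀²`, then the SHORT directions
`{θ ∈ (−π, π) | ∃ r ∈ [w₀, r★], ‖g(r u_θ)‖ ≤ m/2}` have measure at least `π`. [folklore (length–area method)] -/
theorem pi_le_volume_shortDirections {F : Type*} [NormedAddCommGroup F] {g : ℝ × ℝ → F} (hgc : Continuous g)
    {m w₀ rs : ℝ} (hm : 0 < m) (hw₀ : 0 < w₀) (hwr : w₀ < rs) {a : ℝ}
    (ha : ∫ p in polarCoord.symm '' (Icc w₀ rs ×ˢ Ioo (-Real.pi) Real.pi), ‖g p‖ ^ 2 ≤ a)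
    (hroom : 8 * a / (Real.pi * m ^ 2) ≤ rs ^ 2 - w₀ ^ 2) :
    ENNReal.ofReal Real.pi ≤
      volume {θ ∈ Ioo (-Real.pi) Real.pi | ∃ r ∈ Icc w₀ rs, ‖g (polarCoord.symm (r, θ))‖ ≤ m / 2} := by
  set short : Set ℝ := {θ ∈ Ioo (-Real.pi) Real.pi | ∃ r ∈ Icc w₀ rs, ‖g (polarCoord.symm (r, θ))‖ ≤ m / 2}
    with hshort
  have hshortm : MeasurableSet short := measurableSet_shortDirections hgc m w₀ rs
  have hshort_sub : short ⊆ Ioo (-Real.pi) Real.pi := fun θ hθ => hθ.1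
  set long : Set ℝ := Ioo (-Real.pi) Real.pi \ short with hlong
  have hlongm : MeasurableSet long := measurableSet_Ioo.diff hshortm
  have hlong_sub : long ⊆ Ioo (-Real.pi) Real.pi := fun θ hθ => hθ.1
  have hlong_prop : ∀ θ ∈ long, ∀ r ∈ Icc w₀ rs, m / 2 < ‖g (polarCoord.symm (r, θ))‖ := by
    intro θ hθ r hr
    by_contra h
    exact hθ.2 ⟨hθ.1, r, hr, not_lt.1 h⟩
  have hIoofin : volume (Ioo (-Real.pi) Real.pi) ≠ ⊤ := measure_Ioo_lt_top.ne
  have hlongfin : volume long ≠ ⊤ := ((measure_mono hlong_sub).trans_lt measure_Ioo_lt_top).ne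
  have hshortfin : volume short ≠ ⊤ := ((measure_mono hshort_sub).trans_lt measure_Ioo_lt_top).ne
  -- the swept region of the long directions
  set SL : Set (ℝ × ℝ) := Icc w₀ rs ×ˢ long with hSL
  have hSLm : MeasurableSet SL := measurableSet_Icc.prod hlongm
  have hSLsub : SL ⊆ polarCoord.target := by
    rintro ⟨r, θ⟩ ⟨hr, hθ⟩
    rw [polarCoord_target]
    exact ⟨hw₀.trans_le hr.1, hlong_sub hθ⟩
  have hinj : InjOn (fun p : ℝ × ℝ => polarCoord.symm p) SL := by
    have h := polarCoord.symm.injOn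
    rw [OpenPartialHomeomorph.symm_source] at h
    exact h.mono hSLsub
  -- energy density and its pull-back
  set G : ℝ × ℝ → ℝ := fun x => ‖g x‖ ^ 2 with hG
  have hGc : Continuous G := hgc.norm.pow 2
  set Fn : ℝ × ℝ → ℝ := fun p => G (polarCoord.symm p) * p.1 with hFn
  have hFc : Continuous Fn := (hGc.comp continuous_polarCoord_symm).mul continuous_fst
  have hSLcpt : SL ⊆ Icc w₀ rs ×ˢ Icc (-Real.pi) Real.pi := prod_mono le_rfl (hlong_sub.trans Ioo_subset_Icc_self)
  have hFint : IntegrableOn Fn SL :=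
    (hFc.continuousOn.integrableOn_compact (isCompact_Icc.prod isCompact_Icc)).mono_set hSLcpt
  have hfst_int : IntegrableOn (fun p : ℝ × ℝ => p.1) SL :=
    (continuous_fst.continuousOn.integrableOn_compact (isCompact_Icc.prod isCompact_Icc)).mono_set hSLcpt
  -- change of variables on `SL`
  have hcov : ∫ x in polarCoord.symm '' SL, G x = ∫ p in SL, Fn p := by
    rw [integral_image_eq_integral_abs_det_fderiv_smul volume hSLm
      (fun p _ => (hasFDerivAt_polarCoord_symm p).hasFDerivWithinAt) hinj G]
    refine setIntegral_congr_fun hSLm fun p hp => ?_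
    rw [det_fderivPolarCoordSymm, abs_of_pos (hw₀.trans_le hp.1.1), smul_eq_mul, hFn, mul_comm]
  -- lower bound on `SL`: `‖g‖ > m/2`
  have hlow : m ^ 2 / 4 * ((rs ^ 2 - w₀ ^ 2) / 2 * (volume long).toReal) ≤ ∫ p in SL, Fn p := by
    rw [← integral_fst_prod_eq hwr.le long, ← integral_const_mul]
    refine setIntegral_mono_on (hfst_int.const_mul _) hFint hSLm fun p hp => ?_
    have h1 : m / 2 < ‖g (polarCoord.symm (p.1, p.2))‖ := hlong_prop p.2 hp.2 p.1 hp.1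
    have hr0 : 0 ≤ p.1 := hw₀.le.trans hp.1.1
    have h2 : m ^ 2 / 4 ≤ G (polarCoord.symm p) := by
      have h3 : (m / 2) ^ 2 ≤ ‖g (polarCoord.symm p)‖ ^ 2 := pow_le_pow_left₀ (by linarith) h1.le 2
      simp only [hG]
      linarith [h3]
    simp only [hFn]
    exact mul_le_mul_of_nonneg_right h2 hr0
  -- upper bound: the swept long region lies in the full annular sector
  have hK : IsCompact ((fun p : ℝ × ℝ => polarCoord.symm p) '' (Icc w₀ rs ×ˢ Icc (-Real.pi) Real.pi)) :=
    (isCompact_Icc.prod isCompact_Icc).image continuous_polarCoord_symm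
  have hGint : IntegrableOn G (polarCoord.symm '' (Icc w₀ rs ×ˢ Ioo (-Real.pi) Real.pi)) :=
    (hGc.continuousOn.integrableOn_compact hK).mono_set (image_mono (prod_mono le_rfl Ioo_subset_Icc_self))
  have hup : ∫ x in polarCoord.symm '' SL, G x ≤ a := by
    refine le_trans ?_ ha
    exact setIntegral_mono_set hGint (Filter.Eventually.of_forall fun x => sq_nonneg _)
      (ae_of_all _ (image_mono (prod_mono le_rfl hlong_sub)))
  -- combine: `vol(long) ≤ π`
  have hdiff : 0 < rs ^ 2 - w₀ ^ 2 := by nlinarith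
  have hlong_le : (volume long).toReal ≤ Real.pi := by
    have h1 : m ^ 2 / 4 * ((rs ^ 2 - w₀ ^ 2) / 2 * (volume long).toReal) ≤ a := by
      rw [hcov] at hup
      exact hlow.trans hup
    -- `8a/(π m²) ≤ r★² − w₀²`  ⇔  `8a ≤ π m² (r★² − w₀²)`
    have h2 : 8 * a ≤ Real.pi * m ^ 2 * (rs ^ 2 - w₀ ^ 2) := by
      have h := hroom
      rw [div_le_iff₀ (by positivity)] at h
      linarith
    by_contra h3
    push Not at h3
    have h4 : Real.pi * m ^ 2 * (rs ^ 2 - w₀ ^ 2) < m ^ 2 * (rs ^ 2 - w₀ ^ 2) * (volume long).toReal := by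
      have h5 : 0 < m ^ 2 * (rs ^ 2 - w₀ ^ 2) := by positivity
      nlinarith
    nlinarith
  -- `vol(short) = 2π − vol(long) ≥ π`
  have hunion : volume (Ioo (-Real.pi) Real.pi) = volume short + volume long := by
    rw [← measure_union disjoint_sdiff_right hlongm, union_sdiff_cancel hshort_sub]
  have hreal : 2 * Real.pi = (volume short).toReal + (volume long).toReal := by
    have h := congrArg ENNReal.toReal hunion
    rw [Real.volume_Ioo, ENNReal.toReal_ofReal (by linarith [Real.pi_pos]), ENNReal.toReal_add hshortfin hlongfin]
      at h
    linarith
  exact ENNReal.ofReal_le_of_le_toReal (by linarith)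

end Summit.NavierStokesRegularity.NavierStokesRegularity.Theorems.PowerGaugeEulerLiouville.Condenser

end
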